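import Summits.HodgeConjecture.HodgeConjecture.Theses.NikulinTwinTransport
import Literature.AlgebraicGeometry.Surfaces.K3SurfaceProofs

/-!
# Route NikulinTwinTransport · `TwinSimilitudeAlgebraic` (stmt-HodgeConjecture-13674) —
# an explicit rational `2`-similitude of the K3 lattice with its inverse

The twin-transport hypothesis `htwin` of `twinSimilitudeAlgebraic_of_twinTransport`
(`NikulinTwinTransportTwinSimilitudeAlgebraicTransfer`) asks for a `ℂ`-linear `2`-similitude `M` of
`(Λ_ℂ, k3Form)` defined over `ℚ` with a two-sided inverse `N` defined over `ℚ`, algebraic on its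
twin pairs. This file discharges the LATTICE part of that hypothesis with the simplest integral
`2`-similitude of `Λ_{K3} = E₈(−1)^{⊕2} ⊕ U^{⊕3}` (`exists_twoSimilitude_k3Lattice`): on the two
`E₈(−1)`-blocks the sum/difference map `(a, b) ↦ (a + b, a − b)` — a `2`-similitude of `L ⊕ L` for
ANY lattice `L`, `((a+b).(a'+b')) + ((a−b).(a'−b')) = 2(a.a') + 2(b.b')` — and `diag(1, 2)` on each
hyperbolic plane (`U(2) ⊂ U`); its inverse is `(c, d) ↦ ((c+d)/2, (c−d)/2)` and `diag(1, ½)`.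
So only the algebraicity clause of `htwin` — the deliverable of the route's transport crux — remains.
(The route's own completion of the Nikulin similitude, item `EEightTwoSimilitude`, uses a single
`E₈`; any two rational `2`-similitudes of `Λ_ℚ` differ by a rational isometry, so by Buskin's theorem
the choice is immaterial for the transfer.) All matrix identities are block computations
(`Matrix.fromBlocks_multiply`) down to `2 × 2` blocks; multiples `2G` are written `G + G`.
-/

noncomputable section

open scoped Matrix
open Literature.AlgebraicGeometry.Surfaces

namespace Summit.HodgeConjecture.HodgeConjecture.Theorems.NikulinTwinTransport

/-- The sum/difference block `(a, b) ↦ (a + b, a − b)` on `E₈(−1)^{⊕2} ⊗ ℚ`. Local notation only. -/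
local notation3 "AE" => (Matrix.fromBlocks 1 1 1 (-1) : Matrix (Fin 8 ⊕ Fin 8) (Fin 8 ⊕ Fin 8) ℚ)
/-- Its inverse `(c, d) ↦ ((c + d)/2, (c − d)/2)`. Local notation only. -/
local notation3 "BE" => (Matrix.fromBlocks ((2 : ℚ)⁻¹ • 1) ((2 : ℚ)⁻¹ • 1) ((2 : ℚ)⁻¹ • 1)
  (-((2 : ℚ)⁻¹ • 1)) : Matrix (Fin 8 ⊕ Fin 8) (Fin 8 ⊕ Fin 8) ℚ)
/-- `diag(1, 2)` on a hyperbolic plane (`U(2) ⊂ U`). Local notation only. -/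
local notation3 "DU" => (!![1, 0; 0, 2] : Matrix (Fin 2) (Fin 2) ℚ)
/-- Its inverse `diag(1, ½)`. Local notation only. -/
local notation3 "DU'" => (!![1, 0; 0, (2 : ℚ)⁻¹] : Matrix (Fin 2) (Fin 2) ℚ)
/-- The rational hyperbolic plane. Local notation only. -/
local notation3 "UQ" => (hyperbolicPlaneGram.map (Int.cast : ℤ → ℚ) : Matrix (Fin 2) (Fin 2) ℚ)
/-- The block on `U^{⊕3} ⊗ ℚ`. Local notation only. -/
local notation3 "AU" => (Matrix.fromBlocks DU 0 0 (Matrix.fromBlocks DU 0 0 DU) :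
  Matrix (Fin 2 ⊕ (Fin 2 ⊕ Fin 2)) (Fin 2 ⊕ (Fin 2 ⊕ Fin 2)) ℚ)
/-- Its inverse. Local notation only. -/
local notation3 "BU" => (Matrix.fromBlocks DU' 0 0 (Matrix.fromBlocks DU' 0 0 DU') :
  Matrix (Fin 2 ⊕ (Fin 2 ⊕ Fin 2)) (Fin 2 ⊕ (Fin 2 ⊕ Fin 2)) ℚ)
/-- The Gram matrix of `U^{⊕3} ⊗ ℚ`. Local notation only. -/
local notation3 "GU" => (Matrix.fromBlocks UQ 0 0 (Matrix.fromBlocks UQ 0 0 UQ) :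
  Matrix (Fin 2 ⊕ (Fin 2 ⊕ Fin 2)) (Fin 2 ⊕ (Fin 2 ⊕ Fin 2)) ℚ)
/-- The rational `2`-similitude of `Λ_ℚ`. Local notation only. -/
local notation3 "AA" => (Matrix.fromBlocks AE 0 0 AU : Matrix K3Index K3Index ℚ)
/-- Its inverse. Local notation only. -/
local notation3 "BB" => (Matrix.fromBlocks BE 0 0 BU : Matrix K3Index K3Index ℚ)

/-! ### Block algebra -/

/-- Block-diagonal congruence: `diag(P, Q)ᵀ diag(G₁, G₂) diag(P, Q) = diag(Pᵀ G₁ P, Qᵀ G₂ Q)`.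
[folklore] -/
theorem fromBlocks_diag_conj {m n : Type*} [Fintype m] [Fintype n] (P G₁ : Matrix m m ℚ)
    (Q G₂ : Matrix n n ℚ) :
    (Matrix.fromBlocks P 0 0 Q)ᵀ * Matrix.fromBlocks G₁ 0 0 G₂ * Matrix.fromBlocks P 0 0 Q =
      Matrix.fromBlocks (Pᵀ * G₁ * P) 0 0 (Qᵀ * G₂ * Q) := by
  simp [Matrix.fromBlocks_transpose, Matrix.fromBlocks_multiply]

/-- Block-diagonal products: `diag(P, Q) diag(P', Q') = diag(P P', Q Q')`. [folklore] -/
theorem fromBlocks_diag_mul {m n : Type*} [Fintype m] [Fintype n] (P P' : Matrix m m ℚ)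
    (Q Q' : Matrix n n ℚ) :
    Matrix.fromBlocks P 0 0 Q * Matrix.fromBlocks P' 0 0 Q' = Matrix.fromBlocks (P * P') 0 0 (Q * Q') := by
  simp [Matrix.fromBlocks_multiply]

/-- Block-diagonal sums: `diag(P, Q) + diag(P', Q') = diag(P + P', Q + Q')`. [folklore] -/
theorem fromBlocks_diag_add {m n : Type*} (P P' : Matrix m m ℚ) (Q Q' : Matrix n n ℚ) :
    Matrix.fromBlocks P 0 0 Q + Matrix.fromBlocks P' 0 0 Q' = Matrix.fromBlocks (P + P') 0 0 (Q + Q') := by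
  simp only [Matrix.fromBlocks_add, add_zero]

/-! ### The `E₈(−1)^{⊕2}`-block: `(a, b) ↦ (a + b, a − b)` -/

/-- `AE · BE = 1`. [folklore] -/
theorem ae_mul_be : AE * BE = 1 := by
  rw [Matrix.fromBlocks_multiply, ← Matrix.fromBlocks_one]
  simp only [Matrix.neg_mul, Matrix.mul_neg, neg_neg, one_mul]
  congr 1
  · rw [← add_smul]; norm_num
  · rw [add_neg_cancel]
  · rw [add_neg_cancel]
  · rw [← add_smul]; norm_num

/-- `BE · AE = 1`. [folklore] -/
theorem be_mul_ae : BE * AE = 1 := by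
  rw [Matrix.fromBlocks_multiply, ← Matrix.fromBlocks_one]
  simp only [Matrix.mul_one, Matrix.mul_neg, neg_neg]
  congr 1
  · rw [← add_smul]; norm_num
  · rw [add_neg_cancel]
  · rw [add_neg_cancel]
  · rw [← add_smul]; norm_num

/-- **The sum/difference map is a `2`-similitude of `L ⊕ L` for every Gram matrix**:
`AEᵀ diag(−E, −E) AE = 2 diag(−E, −E)`. [folklore] -/
theorem ae_conj (E : Matrix (Fin 8) (Fin 8) ℚ) :
    (AE)ᵀ * Matrix.fromBlocks (-E) 0 0 (-E) * AE = Matrix.fromBlocks (-E + -E) 0 0 (-E + -E) := by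
  rw [Matrix.fromBlocks_transpose, Matrix.transpose_one, Matrix.transpose_neg, Matrix.transpose_one,
    Matrix.fromBlocks_multiply, Matrix.fromBlocks_multiply]
  simp only [Matrix.mul_one, Matrix.mul_zero, add_zero, zero_add, Matrix.neg_mul,
    Matrix.mul_neg, neg_neg, one_mul, neg_add_cancel]

/-! ### The `U^{⊕3}`-block: `diag(1, 2)` on each plane -/

/-- `DU · DU' = 1`. [folklore] -/
theorem du_mul_du' : DU * DU' = 1 := by
  ext i j
  fin_cases i <;> fin_cases j <;> simp [Matrix.mul_apply, Fin.sum_univ_two]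

/-- `DU' · DU = 1`. [folklore] -/
theorem du'_mul_du : DU' * DU = 1 := by
  ext i j
  fin_cases i <;> fin_cases j <;> simp [Matrix.mul_apply, Fin.sum_univ_two]

/-- `DUᵀ U DU = 2U` (`U(2) ⊂ U`). [folklore] -/
theorem du_conj : (DU)ᵀ * UQ * DU = UQ + UQ := by
  ext i j
  fin_cases i <;> fin_cases j <;>
    simp [Matrix.mul_apply, Fin.sum_univ_two, hyperbolicPlaneGram] <;> norm_num

/-- `AU · BU = 1`. [folklore] -/
theorem au_mul_bu : AU * BU = 1 := by
  rw [fromBlocks_diag_mul, fromBlocks_diag_mul, du_mul_du', Matrix.fromBlocks_one, Matrix.fromBlocks_one]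

/-- `BU · AU = 1`. [folklore] -/
theorem bu_mul_au : BU * AU = 1 := by
  rw [fromBlocks_diag_mul, fromBlocks_diag_mul, du'_mul_du, Matrix.fromBlocks_one, Matrix.fromBlocks_one]

/-- `AUᵀ GU AU = 2 GU`. [folklore] -/
theorem au_conj : (AU)ᵀ * GU * AU = GU + GU := by
  rw [fromBlocks_diag_conj, fromBlocks_diag_conj, du_conj, fromBlocks_diag_add, fromBlocks_diag_add]

/-! ### The whole lattice -/

/-- The rational K3 Gram matrix in blocks. [cite: Huybrechts2016K3, Ch. 1 §3.3] -/
theorem k3Gram_map_ratCast :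
    k3Gram.map (Int.cast : ℤ → ℚ) =
      Matrix.fromBlocks
        (Matrix.fromBlocks (-(CartanMatrix.E₈.map (Int.cast : ℤ → ℚ))) 0 0
          (-(CartanMatrix.E₈.map (Int.cast : ℤ → ℚ)))) 0 0 GU := by
  rw [k3Gram]
  simp only [Matrix.fromBlocks_map, Matrix.map_zero (Int.cast : ℤ → ℚ) Int.cast_zero,
    Matrix.map_neg (Int.cast : ℤ → ℚ) (fun a => Int.cast_neg a)]

/-- `AA · BB = 1`. [folklore] -/
theorem aa_mul_bb : AA * BB = 1 := by
  rw [fromBlocks_diag_mul, ae_mul_be, au_mul_bu, Matrix.fromBlocks_one]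

/-- `BB · AA = 1`. [folklore] -/
theorem bb_mul_aa : BB * AA = 1 := by
  rw [fromBlocks_diag_mul, be_mul_ae, bu_mul_au, Matrix.fromBlocks_one]

/-- `AAᵀ Λ_ℚ AA = 2 Λ_ℚ`: `AA` is a rational `2`-similitude of the K3 lattice. [folklore] -/
theorem aa_conj :
    (AA)ᵀ * k3Gram.map (Int.cast : ℤ → ℚ) * AA =
      k3Gram.map (Int.cast : ℤ → ℚ) + k3Gram.map (Int.cast : ℤ → ℚ) := by
  rw [k3Gram_map_ratCast, fromBlocks_diag_conj, ae_conj, au_conj]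
  simp only [Matrix.fromBlocks_add, add_zero]

/-- Rational matrices act compatibly with the inclusion `Λ_ℚ = ℚ²² ⊂ ℂ²² = Λ_ℂ`. [folklore] -/
theorem ratCast_map_mulVec {ι : Type*} [Fintype ι] (X : Matrix ι ι ℚ) (u : ι → ℚ) :
    (X.map (Rat.castHom ℂ)) *ᵥ (fun i => (u i : ℂ)) = fun i => ((X *ᵥ u) i : ℂ) := by
  funext i
  simp only [Matrix.mulVec, dotProduct, Matrix.map_apply, Rat.coe_castHom, Rat.cast_sum, Rat.cast_mul]

/-- **An explicit rational `2`-similitude of the K3 lattice with rational inverse** — the lattice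
part of the twin-transport hypothesis `htwin` of `twinSimilitudeAlgebraic_of_twinTransport`: there
are `ℂ`-linear `M, N : Λ_ℂ → Λ_ℂ` defined over `ℚ`, inverse to each other, with
`(Ma.Mb) = 2 (a.b)` for the K3 form (`M = AA ⊗ ℂ`: sum/difference on `E₈(−1)^{⊕2}`, `diag(1,2)` on
each `U`; `N = BB ⊗ ℂ`). [folklore] -/
theorem exists_twoSimilitude_k3Lattice :
    ∃ (M N : Module.End ℂ (K3Index → ℂ)),
      (∀ v : K3Index → ℤ, ∃ w : K3Index → ℚ, M (fun i => (v i : ℂ)) = fun i => (w i : ℂ)) ∧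
      (∀ v : K3Index → ℤ, ∃ w : K3Index → ℚ, N (fun i => (v i : ℂ)) = fun i => (w i : ℂ)) ∧
      M * N = 1 ∧ N * M = 1 ∧
      (∀ a b, k3Form (M a) (M b) = 2 * k3Form a b) := by
  refine ⟨Matrix.toLin' ((AA).map (Rat.castHom ℂ)), Matrix.toLin' ((BB).map (Rat.castHom ℂ)),
    fun v => ⟨AA *ᵥ fun i => (v i : ℚ), ?_⟩, fun v => ⟨BB *ᵥ fun i => (v i : ℚ), ?_⟩, ?_, ?_, ?_⟩
  · rw [Matrix.toLin'_apply, intCast_eq_ratCast_intCast, ratCast_map_mulVec]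
  · rw [Matrix.toLin'_apply, intCast_eq_ratCast_intCast, ratCast_map_mulVec]
  · rw [Module.End.mul_eq_comp, ← Matrix.toLin'_mul, ← Matrix.map_mul, aa_mul_bb,
      Matrix.map_one _ (map_zero _) (map_one _), Matrix.toLin'_one, Module.End.one_eq_id]
  · rw [Module.End.mul_eq_comp, ← Matrix.toLin'_mul, ← Matrix.map_mul, bb_mul_aa,
      Matrix.map_one _ (map_zero _) (map_one _), Matrix.toLin'_one, Module.End.one_eq_id]
  · intro a b
    have hG : k3Gram.map (Int.cast : ℤ → ℂ) = (k3Gram.map (Int.cast : ℤ → ℚ)).map (Rat.castHom ℂ) := by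
      rw [Matrix.map_map]
      exact Matrix.ext fun i j => by simp
    have hC : ((AA).map (Rat.castHom ℂ))ᵀ * k3Gram.map (Int.cast : ℤ → ℂ) *
        (AA).map (Rat.castHom ℂ) = k3Gram.map (Int.cast : ℤ → ℂ) + k3Gram.map (Int.cast : ℤ → ℂ) := by
      rw [hG, ← Matrix.transpose_map, ← Matrix.map_mul, ← Matrix.map_mul, aa_conj,
        Matrix.map_add (Rat.castHom ℂ) (map_add (Rat.castHom ℂ))]
    rw [Matrix.toLin'_apply, Matrix.toLin'_apply, k3Form_eq_dotProduct, k3Form_eq_dotProduct,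
      ← Matrix.vecMul_transpose ((AA).map _) a]
    simp only [Matrix.dotProduct_mulVec, Matrix.vecMul_vecMul, hC, Matrix.vecMul_add, add_dotProduct,
      two_mul]

end Summit.HodgeConjecture.HodgeConjecture.Theorems.NikulinTwinTransport

end
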